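import Literature.NumberTheory.Automorphic.U3PrincipalSeriesConstituentEmbeds
import Literature.NumberTheory.Automorphic.U3PrincipalSeriesLengthLeTwo
import Literature.NumberTheory.Automorphic.U3SquareIntegrableExponents
import Literature.NumberTheory.Automorphic.U3PrincipalSeriesSubrepSquareIntegrable
import HarnessLib

/-!
# Four `U(3)` principal-series letters (N2, N3, N5, N5′), UNFOLDED as theorems (`Iff.rfl` bridges)

Theorems only (no definition, no named fact, no instance).  Four of the named facts of the T3 «KeysCaseTwo» statement tree of cell
pub/hodgecm-mathlib F0∕P3 — ★ `U3PrincipalSeriesConstituentEmbeds` (N2, [Casselman1995, Cor. 6.3.9 (b)]), ★ `U3PrincipalSeriesLengthLeTwo` (N3,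
[Cor. 7.1.2]), ★ `U3SquareIntegrableExponents` (N5, [Thm. 4.4.6]), ★ `U3PrincipalSeriesSubrepSquareIntegrable` (N5′, [Prop. 7.1.3]) — each a
`def … : Prop`, restated here VERBATIM on the right of an `Iff` proved by `Iff.rfl` (N1 ★ `U3PrincipalSeriesJacquetFiltration`, whose body is the
heaviest, is unfolded in the companion file `U3PrincipalSeriesJacquetFiltrationUnfold`).

WHY THIS FILE EXISTS (an elaboration fact, measured 2026-08-31): Lean abstracts the proof subterms of a DEFINITION's value into private auxiliary
constants (`U3PrincipalSeriesJacquetFiltration._proof_1 … _proof_8`: the instance proofs `IsDomain (𝓞 L⁺)`, `NumberField L⁺`,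
`IsTopologicalGroup U(Φ₃)(L⁺_v)`, `LocallyCompactSpace B(L⁺_v)`, … that sit inside the ≈ 1.8·10⁷-node type of ★ `cmPrincipalSeries L 3 v χ`), one
family PER DEFINITION, whereas THEOREM statements keep the instance terms themselves.  Consequently any proof that lets two letters (or a letter and a
theorem) meet at the carrier `cmPrincipalSeries L 3 v χ` pays a multi-million-heartbeat definitional-equality check (proof irrelevance at every
abstracted leaf of a ≈ 10⁷-node term); e.g. re-ascribing N1's first conjunct to its own source text times out at the default 2·10⁵ heartbeats.  These
bridges pay that price ONCE per letter (under a raised `maxHeartbeats`; measured wall: N2 27 s, N3 17 s, N5 9 s, N5′ 29 s); downstream proofs `rw`∕`.mp` through them and then work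
entirely with theorem-world terms, where the generic Jacquet-module lemmas (★ `JacquetRankStrictMono`, ★ `JacquetNonvanishingOfEmbedding`) apply at
default heartbeats.

## References
[Casselman1995] W. Casselman, *Introduction to the theory of admissible representations of p-adic reductive groups* (draft 1 May 1995), L. 7.1.1,
Cor. 6.3.9, Cor. 7.1.2, Thm. 4.4.6, Prop. 7.1.3 · [BernsteinZelevinsky1977] §2.12–2.14, Thm. 2.8 · [Rogawski1990] §12.2 pp. 173–174.
-/

set_option autoImplicit false

noncomputable section

open MeasureTheory NumberField IsDedekindDomain
open scoped MatrixGroups NNReal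

namespace Literature.NumberTheory.Automorphic

namespace UnitaryGroup

variable (L : Type) [Field L] [NumberField L] [IsCMField L]

set_option maxHeartbeats 4000000 in
/-- **N2 unfolded** (★ `U3PrincipalSeriesConstituentEmbeds`, verbatim body on the right; `Iff.rfl` under a raised heartbeat budget — see the module docstring).
[cite: Casselman1995, Cor. 6.3.9 (b) p. 60; Cor. 6.3.7 p. 59] [cite: BernsteinZelevinsky1977, Thm. 2.5, §2.14 (1)] -/
theorem U3PrincipalSeriesConstituentEmbeds_iff :
    U3PrincipalSeriesConstituentEmbeds L ↔
  ∀ (v : HeightOneSpectrum (𝓞 ↥(maximalRealSubfield L))),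
    (∀ w : PlacesOver L v, IsCMField.complexConj L • w.1 = w.1) →
    ∀ (χ₁ : (LocalRing L v)ˣ →* ℂˣ) (χ₂ : ↥(normOneUnits (conjLocal L (IsCMField.complexConj L) v)) →* ℂˣ),
      Continuous (fun x => ((χ₁ x : ℂˣ) : ℂ)) → Continuous (fun x => ((χ₂ x : ℂˣ) : ℂ)) →
    ∀ c : IrrClass ↥(unitaryGroupOfForm (conjLocal L (IsCMField.complexConj L) v) (cmLocalForm L 3 v)),
      c.IsConstituentOf (cmPrincipalSeries L 3 v (cmTorusCharPair L v χ₁ χ₂)) →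
      ∃ r : SmoothIrrep ↥(unitaryGroupOfForm (conjLocal L (IsCMField.complexConj L) v) (cmLocalForm L 3 v)), IrrClass.mk r = c ∧
        ((∃ f : r.ρ.IntertwiningMap (cmPrincipalSeries L 3 v (cmTorusCharPair L v χ₁ χ₂)), Function.Injective f) ∨
         (∃ f : r.ρ.IntertwiningMap (cmPrincipalSeries L 3 v (cmWeylTorusCharPair L v χ₁ χ₂)), Function.Injective f)) :=
  Iff.rfl

set_option maxHeartbeats 4000000 in
/-- **N3 unfolded** (★ `U3PrincipalSeriesLengthLeTwo`, verbatim body on the right; `Iff.rfl` under a raised heartbeat budget — see the module docstring).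
[cite: Casselman1995, Cor. 7.1.2 p. 67] [cite: BernsteinZelevinsky1977, Thm. 2.8 p. 448] -/
theorem U3PrincipalSeriesLengthLeTwo_iff :
    U3PrincipalSeriesLengthLeTwo L ↔
  ∀ (v : HeightOneSpectrum (𝓞 ↥(maximalRealSubfield L))),
    (∀ w : PlacesOver L v, IsCMField.complexConj L • w.1 = w.1) →
    ∀ (χ₁ : (LocalRing L v)ˣ →* ℂˣ) (χ₂ : ↥(normOneUnits (conjLocal L (IsCMField.complexConj L) v)) →* ℂˣ),
      Continuous (fun x => ((χ₁ x : ℂˣ) : ℂ)) → Continuous (fun x => ((χ₂ x : ℂˣ) : ℂ)) →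
    ∀ N₁ N₂ : Subrepresentation (cmPrincipalSeries L 3 v (cmTorusCharPair L v χ₁ χ₂)),
      ¬ (⊥ < N₁ ∧ N₁ < N₂ ∧ N₂ < ⊤) :=
  Iff.rfl

set_option maxHeartbeats 4000000 in
/-- **N5 unfolded** (★ `U3SquareIntegrableExponents`, verbatim body on the right; `Iff.rfl` under a raised heartbeat budget — see the module docstring).
[cite: Casselman1995, Thm. 4.4.6 p. 45; §1.4 p. 13; §2.5 p. 28] [cite: Rogawski1990, §12.2 (2) p. 174] -/
theorem U3SquareIntegrableExponents_iff :
    U3SquareIntegrableExponents L ↔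
  ∀ (v : HeightOneSpectrum (𝓞 ↥(maximalRealSubfield L))),
    (∀ w : PlacesOver L v, IsCMField.complexConj L • w.1 = w.1) →
    ∀ [MeasurableSpace
          (↥(unitaryGroupOfForm (conjLocal L (IsCMField.complexConj L) v) (cmLocalForm L 3 v)) ⧸
            Subgroup.center ↥(unitaryGroupOfForm (conjLocal L (IsCMField.complexConj L) v) (cmLocalForm L 3 v)))]
      [BorelSpace
          (↥(unitaryGroupOfForm (conjLocal L (IsCMField.complexConj L) v) (cmLocalForm L 3 v)) ⧸
            Subgroup.center ↥(unitaryGroupOfForm (conjLocal L (IsCMField.complexConj L) v) (cmLocalForm L 3 v)))]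
      (μZ : Measure
          (↥(unitaryGroupOfForm (conjLocal L (IsCMField.complexConj L) v) (cmLocalForm L 3 v)) ⧸
            Subgroup.center ↥(unitaryGroupOfForm (conjLocal L (IsCMField.complexConj L) v) (cmLocalForm L 3 v))))
      [μZ.IsHaarMeasure],
    ∀ (V : Type) [AddCommGroup V] [Module ℂ V]
      (π : Representation ℂ ↥(unitaryGroupOfForm (conjLocal L (IsCMField.complexConj L) v) (cmLocalForm L 3 v)) V),
      π.IsAdmissible →
    ∀ (ω : ↥(Subgroup.center ↥(unitaryGroupOfForm (conjLocal L (IsCMField.complexConj L) v) (cmLocalForm L 3 v))) →* ℂˣ),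
      (∀ (z : ↥(Subgroup.center ↥(unitaryGroupOfForm (conjLocal L (IsCMField.complexConj L) v) (cmLocalForm L 3 v)))) (x : V),
        π (z : ↥(unitaryGroupOfForm (conjLocal L (IsCMField.complexConj L) v) (cmLocalForm L 3 v))) x = ((ω z : ℂˣ) : ℂ) • x) →
    haveI := locallyCompactSpace_cmBorelU L 3 v
    (((∀ z, ‖((ω z : ℂˣ) : ℂ)‖ = 1) ∧ π.IsSquareIntegrableModCenter μZ) ↔
      ((∀ z, ‖((ω z : ℂˣ) : ℂ)‖ = 1) ∧
        ∀ χ' : ↥(cmBorelTriple L 3 v).M →* ℂˣ, π.HasJacquetExponent (cmBorelTriple L 3 v) χ' →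
          ∀ a : ↥(cmBorelTriple L 3 v).M,
            conjLocal L (IsCMField.complexConj L) v
                ((torusEntry (conjLocal L (IsCMField.complexConj L) v) (cmLocalForm L 3 v) 0 a : (LocalRing L v)ˣ) : LocalRing L v) =
              ((torusEntry (conjLocal L (IsCMField.complexConj L) v) (cmLocalForm L 3 v) 0 a : (LocalRing L v)ˣ) : LocalRing L v) →
            torusEntry (conjLocal L (IsCMField.complexConj L) v) (cmLocalForm L 3 v) 1 a = 1 →
            unitModulusChar (LocalRing L v) (torusEntry (conjLocal L (IsCMField.complexConj L) v) (cmLocalForm L 3 v) 0 a) < 1 →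
            ‖((χ' a : ℂˣ) : ℂ)‖ < 1)) :=
  Iff.rfl

set_option maxHeartbeats 4000000 in
/-- **N5′ unfolded** (★ `U3PrincipalSeriesSubrepSquareIntegrable`, verbatim body on the right; `Iff.rfl` under a raised heartbeat budget — see the module docstring).
[cite: Casselman1995, Prop. 7.1.3 p. 67; §1.4 p. 13] [cite: Rogawski1990, §12.2 (2) p. 174] -/
theorem U3PrincipalSeriesSubrepSquareIntegrable_iff :
    U3PrincipalSeriesSubrepSquareIntegrable L ↔
  ∀ (v : HeightOneSpectrum (𝓞 ↥(maximalRealSubfield L))),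
    (∀ w : PlacesOver L v, IsCMField.complexConj L • w.1 = w.1) →
    ∀ (χ₁ : (LocalRing L v)ˣ →* ℂˣ) (χ₂ : ↥(normOneUnits (conjLocal L (IsCMField.complexConj L) v)) →* ℂˣ),
      Continuous (fun x => ((χ₁ x : ℂˣ) : ℂ)) → Continuous (fun x => ((χ₂ x : ℂˣ) : ℂ)) →
      (∀ t : (LocalRing L v)ˣ, conjLocal L (IsCMField.complexConj L) v (t : LocalRing L v) = t →
        unitModulusChar (LocalRing L v) t < 1 → ‖((χ₁ t : ℂˣ) : ℂ)‖ < 1) →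
    ∀ [MeasurableSpace
          (↥(unitaryGroupOfForm (conjLocal L (IsCMField.complexConj L) v) (cmLocalForm L 3 v)) ⧸
            Subgroup.center ↥(unitaryGroupOfForm (conjLocal L (IsCMField.complexConj L) v) (cmLocalForm L 3 v)))]
      [BorelSpace
          (↥(unitaryGroupOfForm (conjLocal L (IsCMField.complexConj L) v) (cmLocalForm L 3 v)) ⧸
            Subgroup.center ↥(unitaryGroupOfForm (conjLocal L (IsCMField.complexConj L) v) (cmLocalForm L 3 v)))]
      (μZ : Measure
          (↥(unitaryGroupOfForm (conjLocal L (IsCMField.complexConj L) v) (cmLocalForm L 3 v)) ⧸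
            Subgroup.center ↥(unitaryGroupOfForm (conjLocal L (IsCMField.complexConj L) v) (cmLocalForm L 3 v))))
      [μZ.IsHaarMeasure],
    ∀ N : Subrepresentation (cmPrincipalSeries L 3 v (cmTorusCharPair L v χ₁ χ₂)), N ≠ ⊤ →
      N.toRepresentation.IsSquareIntegrableModCenter μZ :=
  Iff.rfl

end UnitaryGroup

end Literature.NumberTheory.Automorphic

end
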